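import Summits.QuantumFields.YangMills.Theorems.BalabanUVNodesN15TwoGridDressedFirstOrderNoFit
import Summits.QuantumFields.YangMills.Theorems.BalabanUVNodesN15TwoGridBackgroundSupCarrierFullG
import Summits.QuantumFields.YangMills.Theorems.BalabanUVNodesN15BackgroundLayerFirstOrder
import Summits.QuantumFields.YangMills.Theorems.BalabanUVNodesN15BackgroundCoefficientTaylor
import HarnessLib

/-!
# N15 (NE2) — PROGRAMME M-II «THE FIRST-ORDER LAYER BY PARTS», part II-E: ★★★ `T4EtaRate.NE2PlusOperator` BY NAME, HYPOTHESIS-FREE, FOR BAŁABAN's FULL PAIR DRESSED BY THE FIRST-ORDER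
# SPECIES ON THE CARRIER WHOSE (3.35) IS «|U|, |∇′U|» ALONE — sup of `c′`, `a′_μ` and of the FIRST difference quotients of `a′_μ`; NOTHING on `∇c′`, `∇∇a′`, no fit clause

WHO ∕ WHEN.  Cell `pub-ymgap`, seat `pub-ymgap-dag-n15-a` (KNIT-BY-NAME seat of Track-A DAG node N15 = NE2, g24); `--kind proof --supports stmt-QuantumFields-27366 --as helper` (K3⁸;
count-neutral).  Over part II-D `…TwoGridDressedFirstOrderNoFit` (★★★ `hasMaj_idef_bgPairValue_gOp`), M-E∕M-F `…TwoGridBackgroundSupCarrier(FullG)` (`supT` = entries 1–3, `unitTorusGeoS` plumbing,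
`one_le_pref4`, `abs_le_iSup_abs`), n15-b B4 `…BackgroundLayerFirstOrder` (`avg₁`, `avg₁_zero`), n15-c FILE 10 `…BackgroundCoefficientTaylor` (★ `fibreOsc_of_fgrad`: block oscillation from the fine
gradient; `fgrad`, `bshiftEquiv`), `T4EtaRateCoeffDefect.fit_blockAvg`, g0 `etaRateIneq342_of_hasMaj_rateWeight`, parts 59∕71∕72 (`hasMaj_tgT1`, `hasMaj_tgT2`, `hasMaj_twoGridDefect_lap`,
`hasMaj_rescale`), `GenuineRecord.TGIndexS` BY NAME; nothing in the tree is modified.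

WHAT.  §22 plumbing `def`s: the FIRST-ORDER COEFFICIENT CARRIER `coeffBgFO M n M_sz` — configurations `U = (c′, a′_μ)` on the `n`-torus 1-forms, `one := 0`, `mul := (+)`,
`Reg335 c α₀ U := (∀ z, |c′ z| ≤ cM_szα₀) ∧ (∀ μ z, |a′_μ z| ≤ cM_szα₀) ∧ (∀ μ κ z, |∇′_κ a′_μ (z)| ≤ cM_szα₀)` (`∇′_κ = fgrad n (bshiftEquiv κ)`) — the shape of [B9] (3.35) «|A|, |∇^ηA| <
O(1)Mα₀(·)»; `Reg336` the same, (3.37)–(3.38) inert; the pairing `foPairing` (King's pairing, `avg := avg₁ = blockAvg` componentwise), the entry operators `foOps` (entry 0 = the η-defect of the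
VALUES of the first-order dressed pair `(1 − G′V₁′)⁻¹G′`, `(1 − GV₁)⁻¹G`, `V₁′ = M_{c′} + Σ_μ M_{a′_μ}∇′_μ`; entries 1–3 = M-F's `supT`, U-blind), the sized instance ∕ family `foInstanceFG` ∕ `foFamilyFG`
at Bałaban's `(Δ′_a⁻¹, Δ_a⁻¹)`; `foInstanceFG_gf_M` (guard LIVE), `foInstanceFG_cofinal`.  §23 `abs_bquot_le_of_fgrad` (backward quotient from the carrier's forward clause), `osc_rate_le` (the
derived fit `2(d+1)(L^m − 1)r∕L^{m+k} ≤ 2(d+1)r₀·(L^k)^{−γ₀}`), ★★★ `ne2PlusOperator_firstOrder_fullG (hLodd) (hL3 : 3 ≤ L) (hL) (ha : 0 < a) (c₃₅) (hc₃₅) (ν μ) :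
NE2PlusOperator c₃₅ (foInstanceFG d hL) (foFamilyFG d hL a ν μ)` — HYPOTHESIS-FREE; ★★ `ne2ZeroOperator_firstOrder_fullG`.
HOW.  Unfold `NE2PlusOperator` with `M₅ = 1`, `a₀ = r₀∕c₃₅` (II-D's window: the guard `M_szα₀ ≤ a₀` puts `r = c₃₅M_szα₀ ≤ r₀`), `γ = γ₀ = min(1∕16, 1∕(8(d+1)))`, `δ₀ = min δ_E ρ₃`,
`B₀ = max (B(1 + 2(d+1)r₀)) B₃`; entry 0 = II-D at `γ := 2γ₀` with `r_b = r` (the forward clause re-indexed) and `o_a = 2(d+1)(L^m−1)r∕L^{m+k}` (`fibreOsc_of_fgrad` + `fit_blockAvg`);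
entries 1–3 as M-F; `etaRateIneq342_of_hasMaj_rateWeight`.

HONEST FRAMING ∕ LIMITS.  HYBRID family: the background is LIVE in entry 0 only (entries 1–3 are the pair's own `U ≡ 1` η-defects — a dressed gradient∕divergence∕Laplacian entry needs the
mixed row «∇G∇*», located); abelianised scalar-multiplier MODEL of (3.52)'s `V′(A)`, block-averaged coarse partner (C3); GENUINE in the propagators; the regularity class is the
(3.35)-SHAPED PAIR of sup letters and NOTHING ELSE (vs n15-b B4 `coeffBg₁`: oscillation of `c′`; n15-c FILE 11 `coeffBgC2`: `|∇′c′|`, `|∇′∇′a′|`).  NE2⁺ as printed NOT PRINTED ∕ proved;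
no statement of record touched; N15 NOT discharged; K3⁸ OPEN; counts UNMOVED (typed 28∕28 · discharged 5∕27); NOT infinite volume ∕ OS ∕ mass gap ∕ Clay.
-/

noncomputable section

open scoped BigOperators
open Finset

namespace Summit.QuantumFields.YangMills.BalabanUVNodes.N15.TwoGrid

open Literature.MathematicalPhysics.QuantumFieldTheory.Balaban1983to89
open Literature.MathematicalPhysics.QuantumFieldTheory.Balaban1983to89.B11SectG (BlockNorm HasMaj)
open Literature.MathematicalPhysics.QuantumFieldTheory.Balaban1983to89.T4EtaRate (PairedInstance EtaPairing EtaRateIneq342 NE2PlusOperator NE2ZeroOperator ne2Zero_of_ne2Plus)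
open Literature.MathematicalPhysics.QuantumFieldTheory.Balaban1983to89.T4EtaRateDefect (idef rateWeight)
open Literature.MathematicalPhysics.QuantumFieldTheory.Balaban1983to89.T4EtaRateCoeffDefect (pull blockAvg fit_blockAvg)
open Literature.MathematicalPhysics.QuantumFieldTheory.Balaban1983to89.B5Prop11Plancherel (Tor fine unitVec)
open Literature.MathematicalPhysics.QuantumFieldTheory.Balaban1983to89.B5SiteBridgeP12 (MP)
open Literature.MathematicalPhysics.QuantumFieldTheory.King1986.Torus (blockOf tdistT tdistT_nonneg)
open Literature.MathematicalPhysics.QuantumFieldTheory.Balaban1983to89.B6UnitTorusCarrier (unitTorusGeo)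
open Summit.QuantumFields.YangMills.BalabanUVNodes.N15.VectorPiece (blkFine kingPrV blkFine_comp_kingPrV unitTorusGeoS rateWeight_unitTorusGeoS bshiftEquiv bshiftEquiv_apply)
open Summit.QuantumFields.YangMills.BalabanUVNodes.N15.OperatorReadout (opGeo opFamily opGeo_len etaRateIneq342_of_hasMaj_rateWeight)
open Summit.QuantumFields.YangMills.BalabanUVNodes.N15.BackgroundLayer (bgPair projO fineGeo one_le_pref4 abs_le_iSup_abs avg₁ avg₁_zero fgrad fgrad_apply fibreOsc_of_fgrad)
open Summit.QuantumFields.YangMills.BalabanUVNodes.N15.GenuineRecord (TGIndexS tgIndexS_cofinal)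

variable {d : ℕ}

/-! ## §22 The first-order coefficient carrier with the (3.35)-shaped letter pair, the pairing, the entry operators, the sized instances -/

section Carrier

variable {L : ℕ} [NeZero L] (M : Fin (d + 1) → ℕ) [∀ μ, NeZero (M μ)]

/-- **THE FIRST-ORDER COEFFICIENT CARRIER WITH THE (3.35)-SHAPED LETTER PAIR ALONE**: configurations `U = (c′, a′_μ)` — a zeroth-order coefficient and `d+1` first-order coefficients on the
`n`-torus 1-forms (the abelianised species `V₁′ = M_{c′} + Σ_μ M_{a′_μ}∇′_μ` of (3.52)); `one := 0`, `mul := (+)`; `Reg335 c α₀ U :=` sup letters `|c′|, |a′_μ| ≤ cM_szα₀` AND the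
first-quotient letter `|∇′_κa′_μ| ≤ cM_szα₀` (all directions) — NO clause on `∇′c′`, `∇′∇′a′`, no block-fit clause; `Reg336` the same; (3.37)–(3.38) inert.
[cite: Balaban1985BackgroundPropagators, (3.35) p.396 («|A| < O(1)Mα₀(L^jη)^{−1}, |∇^ηA| < O(1)Mα₀(L^jη)^{−2}»: the letter pair, shape), (3.52) p.400 (first-order species: shape)] -/
def coeffBgFO (n : ℕ) [NeZero n] (Msz : ℝ) : B9.Backgrounds where
  Cfg := (Tor (fine n M) × Fin (d + 1) → ℝ) × (Fin (d + 1) → Tor (fine n M) × Fin (d + 1) → ℝ)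
  one := 0
  mul := fun U₁ U₂ => U₁ + U₂
  Reg335 := fun c α₀ U =>
    (∀ z, |U.1 z| ≤ c * Msz * α₀) ∧ (∀ μ z, |U.2 μ z| ≤ c * Msz * α₀) ∧ ∀ μ κ z, |fgrad (n : ℝ) (bshiftEquiv M n κ) (U.2 μ) z| ≤ c * Msz * α₀
  Reg336 := fun c α₀ U =>
    (∀ z, |U.1 z| ≤ c * Msz * α₀) ∧ (∀ μ z, |U.2 μ z| ≤ c * Msz * α₀) ∧ ∀ μ κ z, |fgrad (n : ℝ) (bshiftEquiv M n κ) (U.2 μ) z| ≤ c * Msz * α₀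
  Cplx337 := fun _ _ _ => True
  Cplx338 := fun _ _ _ => True

omit [NeZero L] [∀ μ, NeZero (M μ)] in
/-- Unfolding of the carrier's (3.35). [folklore] -/
theorem reg335_coeffBgFO_iff (n : ℕ) [NeZero n] (Msz c α₀ : ℝ) (U : (Tor (fine n M) × Fin (d + 1) → ℝ) × (Fin (d + 1) → Tor (fine n M) × Fin (d + 1) → ℝ)) :
    (coeffBgFO M n Msz).Reg335 c α₀ U ↔
      (∀ z, |U.1 z| ≤ c * Msz * α₀) ∧ (∀ μ z, |U.2 μ z| ≤ c * Msz * α₀) ∧ ∀ μ κ z, |fgrad (n : ℝ) (bshiftEquiv M n κ) (U.2 μ) z| ≤ c * Msz * α₀ := Iff.rfl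

variable (k m : ℕ) (Msz : ℝ)

/-- THE η-PAIRING over the first-order carriers on the King torus (sized carrier `unitTorusGeoS`, King blocks, King's pairing; `avg := avg₁` = `blockAvg` componentwise, `τ := pull`; NOT
PRINTED data — M-E's `bgPairingSup` with the carriers replaced). [cite: King1986, p.664 (convention before Prop. 3.8)] -/
def foPairing : EtaPairing (opGeo (unitTorusGeoS L k M Msz) (Tor (fine (L ^ k) M) × Fin (d + 1)) (blkFine L k M))
    (fineGeo (unitTorusGeoS L k M Msz) (Tor (fine (L ^ m * L ^ k) M) × Fin (d + 1)) (blkFine L k M ∘ kingPrV L k m M) m)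
    (coeffBgFO M (L ^ k) Msz) (coeffBgFO M (L ^ m * L ^ k) Msz) where
  n := m
  k_eq := rfl
  L_eq := rfl
  M_eq := rfl
  eta_eq := by
    show ((L : ℝ) ^ k)⁻¹ * ((L : ℝ) ^ m)⁻¹ * (L : ℝ) ^ m = ((L : ℝ) ^ k)⁻¹
    rw [mul_assoc, inv_mul_cancel₀ (pow_ne_zero _ (Nat.cast_ne_zero.mpr (NeZero.ne L))), mul_one]
  ι := fun y => y
  scale_ι := fun _ => rfl
  dist_ι := fun _ _ => rfl
  τ := fun lam => pull (kingPrV L k m M) lam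
  suppIn_τ := fun _ _ h x' hx' => h (kingPrV L k m M x') hx'
  supNorm_τ := fun lam => by
    show (⨆ x', |lam (kingPrV L k m M x')|) ≤ ⨆ x, |lam x|
    exact Real.iSup_le (fun x' => abs_le_iSup_abs lam (kingPrV L k m M x')) (Real.iSup_nonneg fun x => abs_nonneg _)
  avg := fun U => avg₁ (Fin (d + 1)) (kingPrV L k m M) U
  avg_one := avg₁_zero (Fin (d + 1)) (kingPrV L k m M)

/-- THE FOUR ENTRY OPERATORS of the first-order layer at pieces `G` (coarse), `G′` (fine): entry 0 = `𝔇(X′(U), X(avg U))` — the VALUES of the first-order dressed pair (n15-b's `bgPair` with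
`D_μ := ∇_μ∘G`, value component), background LIVE; entries 1–3 the consumer's `T`. [cite: Balaban1985BackgroundPropagators, (3.42) p.397 (the four sup entries: shape), (3.62)–(3.65) pp.402–403] -/
def foOps (G : (Tor (fine (L ^ k) M) × Fin (d + 1) → ℝ) →ₗ[ℝ] (Tor (fine (L ^ k) M) × Fin (d + 1) → ℝ))
    (G' : (Tor (fine (L ^ m * L ^ k) M) × Fin (d + 1) → ℝ) →ₗ[ℝ] (Tor (fine (L ^ m * L ^ k) M) × Fin (d + 1) → ℝ))
    (T : Fin 3 → (coeffBgFO M (L ^ m * L ^ k) Msz).Cfg → ((Tor (fine (L ^ k) M) × Fin (d + 1) → ℝ) →ₗ[ℝ] (Tor (fine (L ^ m * L ^ k) M) × Fin (d + 1) → ℝ))) :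
    Fin 4 → (coeffBgFO M (L ^ m * L ^ k) Msz).Cfg → ((Tor (fine (L ^ k) M) × Fin (d + 1) → ℝ) →ₗ[ℝ] (Tor (fine (L ^ m * L ^ k) M) × Fin (d + 1) → ℝ)) :=
  fun i U => ![idef (pull (kingPrV L k m M)) (pull (kingPrV L k m M))
      (projO none ∘ₗ bgPair G' (fun μ => symbOp M (L ^ m * L ^ k) (sD M (L ^ m * L ^ k) μ ((L ^ m * L ^ k : ℕ) : ℝ)) ∘ₗ G') U.1 U.2)
      (projO none ∘ₗ bgPair G (fun μ => symbOp M (L ^ k) (sD M (L ^ k) μ ((L ^ k : ℕ) : ℝ)) ∘ₗ G) (blockAvg (kingPrV L k m M) U.1) (fun μ => blockAvg (kingPrV L k m M) (U.2 μ))),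
    T 0 U, T 1 U, T 2 U] i

end Carrier

section Sized

variable (d) {L : ℕ} [NeZero L]

/-- THE REALISED PAIRED INSTANCE at a sized index (torus `M_ν = 2L^{m_T}`, runs `k`, `k + m`, size `M_sz`) over the first-order carriers. [cite: Balaban1985BackgroundPropagators, Thm 3.14 pp.426–427 (typing template)] -/
def foInstanceFG (hL : Odd L ∧ 1 < L) (j : TGIndexS) : PairedInstance :=
  ⟨opGeo (unitTorusGeoS L j.k (TGIndex.Mn d hL j.toTGIndex) j.Msz) (Tor (fine (L ^ j.k) (TGIndex.Mn d hL j.toTGIndex)) × Fin (d + 1)) (blkFine L j.k (TGIndex.Mn d hL j.toTGIndex)),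
    fineGeo (unitTorusGeoS L j.k (TGIndex.Mn d hL j.toTGIndex) j.Msz) (Tor (fine (L ^ j.m * L ^ j.k) (TGIndex.Mn d hL j.toTGIndex)) × Fin (d + 1))
      (blkFine L j.k (TGIndex.Mn d hL j.toTGIndex) ∘ kingPrV L j.k j.m (TGIndex.Mn d hL j.toTGIndex)) j.m,
    coeffBgFO (TGIndex.Mn d hL j.toTGIndex) (L ^ j.k) j.Msz, coeffBgFO (TGIndex.Mn d hL j.toTGIndex) (L ^ j.m * L ^ j.k) j.Msz,
    foPairing (TGIndex.Mn d hL j.toTGIndex) j.k j.m j.Msz⟩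

/-- THE GUARD IS LIVE: `(gf j).M = M_sz`. [folklore] -/
theorem foInstanceFG_gf_M (hL : Odd L ∧ 1 < L) (j : TGIndexS) : (foInstanceFG d hL j).gf.M = j.Msz := rfl

/-- The index family is cofinal in the size and the coarse scale: the guard `M₅ ≤ M` excludes nothing uniformly. [folklore] -/
theorem foInstanceFG_cofinal (hL : Odd L ∧ 1 < L) (M₅ : ℝ) (k₀ : ℕ) : ∃ j : TGIndexS, M₅ ≤ (foInstanceFG d hL j).gf.M ∧ k₀ ≤ j.k := tgIndexS_cofinal M₅ k₀

/-- THE KERNEL FAMILY at a sized index: `foOps` at Bałaban's `G := Δ_a⁻¹` (spacing `L^{−k}`), `G′ := Δ′_a⁻¹` (spacing `L^{−(m+k)}`), entries 1–3 = M-F's `supT` (U-blind), read through `opFamily`.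
[cite: Balaban1985BackgroundPropagators, (3.42) p.397 (shape), (3.62)–(3.65) pp.402–403 (mechanism)] -/
def foFamilyFG (hL : Odd L ∧ 1 < L) (a : ℝ) (ν μ : Fin (d + 1)) (j : TGIndexS) : B9.KernelFamily (foInstanceFG d hL j).gc (foInstanceFG d hL j).Bf :=
  show B9.KernelFamily (opGeo (unitTorusGeoS L j.k (TGIndex.Mn d hL j.toTGIndex) j.Msz) (Tor (fine (L ^ j.k) (TGIndex.Mn d hL j.toTGIndex)) × Fin (d + 1))
      (blkFine L j.k (TGIndex.Mn d hL j.toTGIndex))) (coeffBgFO (TGIndex.Mn d hL j.toTGIndex) (L ^ j.m * L ^ j.k) j.Msz) from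
    opFamily (g := unitTorusGeoS L j.k (TGIndex.Mn d hL j.toTGIndex) j.Msz) (B := coeffBgFO (TGIndex.Mn d hL j.toTGIndex) (L ^ j.m * L ^ j.k) j.Msz)
      (blkFine L j.k (TGIndex.Mn d hL j.toTGIndex)) (blkFine L j.k (TGIndex.Mn d hL j.toTGIndex) ∘ kingPrV L j.k j.m (TGIndex.Mn d hL j.toTGIndex))
      (foOps (TGIndex.Mn d hL j.toTGIndex) j.k j.m j.Msz (gOp (TGIndex.Mn d hL j.toTGIndex) (L ^ j.k) a) (gOp (TGIndex.Mn d hL j.toTGIndex) (L ^ j.m * L ^ j.k) a)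
        fun n U => supT d hL a ν μ j n U.1)

end Sized

/-! ## §23 ★★★ `NE2PlusOperator` BY NAME, hypothesis-free -/

section Main

variable {L : ℕ} [NeZero L] (M : Fin (d + 1) → ℕ) [∀ μ, NeZero (M μ)] (k m : ℕ)

omit [NeZero L] [∀ μ, NeZero (M μ)] in
/-- THE BACKWARD QUOTIENT LETTER FROM THE CARRIER's FORWARD CLAUSE: `|n(a(z) − a(z − e_μ))| = |∇′_μa (z − e_μ)|`. [folklore] -/
theorem abs_bquot_le_of_fgrad {n : ℕ} [NeZero n] {a : Tor (fine n M) × Fin (d + 1) → ℝ} {r : ℝ} (μ : Fin (d + 1)) (h : ∀ z, |fgrad (n : ℝ) (bshiftEquiv M n μ) a z| ≤ r)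
    (z : Tor (fine n M) × Fin (d + 1)) : |(n : ℝ) * (a z - a (z.1 - unitVec (fine n M) μ, z.2))| ≤ r := by
  have e := h (z.1 - unitVec (fine n M) μ, z.2)
  rwa [fgrad_apply, bshiftEquiv_apply, sub_add_cancel] at e

omit [NeZero L] in
/-- THE DERIVED FIT IS ONE RATE FACTOR BELOW THE GRADIENT LETTER: `2(d+1)(L^m − 1)·(r∕L^{m+k}) ≤ 2(d+1)r₀·(L^k)^{−γ}` for `0 ≤ r ≤ r₀`, `γ ≤ 1`, `L ≥ 1`. [folklore] -/
theorem osc_rate_le (hL1 : (1 : ℝ) ≤ (L : ℝ)) {r r₀ γ : ℝ} (hr : 0 ≤ r) (hrr₀ : r ≤ r₀) (hγ1 : γ ≤ 1) :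
    ((2 * ((d + 1) * (L ^ m - 1)) : ℕ) : ℝ) * (r / ((L ^ m * L ^ k : ℕ) : ℝ)) ≤ 2 * ((d : ℝ) + 1) * r₀ * ((L : ℝ) ^ k) ^ (-γ) := by
  have hLm : (0 : ℝ) < (L : ℝ) ^ m := pow_pos (by linarith) _
  have hLk : (0 : ℝ) < (L : ℝ) ^ k := pow_pos (by linarith) _
  have hx1 : (1 : ℝ) ≤ (L : ℝ) ^ k := one_le_pow₀ hL1
  have hcast : ((2 * ((d + 1) * (L ^ m - 1)) : ℕ) : ℝ) ≤ 2 * ((d : ℝ) + 1) * (L : ℝ) ^ m := by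
    have h1 : ((L ^ m - 1 : ℕ) : ℝ) ≤ (L : ℝ) ^ m := by exact_mod_cast Nat.sub_le _ _
    have h2 : ((2 * ((d + 1) * (L ^ m - 1)) : ℕ) : ℝ) = 2 * (((d : ℝ) + 1) * ((L ^ m - 1 : ℕ) : ℝ)) := by push_cast; ring
    rw [h2]; nlinarith
  have hrate : ((L : ℝ) ^ k)⁻¹ ≤ ((L : ℝ) ^ k) ^ (-γ) := by
    rw [← Real.rpow_neg_one]; exact Real.rpow_le_rpow_of_exponent_le hx1 (by linarith)
  have hq : r / ((L ^ m * L ^ k : ℕ) : ℝ) = r * ((L : ℝ) ^ m)⁻¹ * ((L : ℝ) ^ k)⁻¹ := by push_cast; rw [div_eq_mul_inv, mul_inv]; ring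
  rw [hq]
  calc ((2 * ((d + 1) * (L ^ m - 1)) : ℕ) : ℝ) * (r * ((L : ℝ) ^ m)⁻¹ * ((L : ℝ) ^ k)⁻¹)
      ≤ (2 * ((d : ℝ) + 1) * (L : ℝ) ^ m) * (r₀ * ((L : ℝ) ^ m)⁻¹ * ((L : ℝ) ^ k) ^ (-γ)) :=
        mul_le_mul hcast (mul_le_mul (mul_le_mul_of_nonneg_right hrr₀ (inv_nonneg.mpr hLm.le)) hrate (inv_nonneg.mpr hLk.le)
          (mul_nonneg (hr.trans hrr₀) (inv_nonneg.mpr hLm.le))) (by positivity) (by positivity)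
    _ = 2 * ((d : ℝ) + 1) * r₀ * ((L : ℝ) ^ k) ^ (-γ) := by field_simp

variable (d)

/-- ★★★ **NE2⁺, OPERATOR LAYER — `T4EtaRate.NE2PlusOperator` BY NAME, HYPOTHESIS-FREE, FOR BAŁABAN's FULL PAIR DRESSED BY THE FIRST-ORDER SPECIES ON THE (3.35)-PAIR CARRIER.**  For odd
`L ≥ 3`, `a > 0`, `c₃₅ > 0`, directions `ν, μ`: `NE2PlusOperator c₃₅ (foInstanceFG d hL) (foFamilyFG d hL a ν μ)`.  (3.35) is consumed as the sup of the coefficients and of the first quotients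
of `a′` — NOTHING on `∇c′`; the size guard is LIVE (cofinal family); `M_sz·α₀ ≤ a₀ = r₀∕c₃₅` drives both Neumann contractions; entry 0 carries the background GENUINELY (II-D); entries 1–3 are
the pair's `U ≡ 1` η-defects (M-F); common rate number `(L^k)^{−γ₀}`, `γ₀ = min(1∕16, 1∕(8(d+1)))`. [cite: Balaban1985BackgroundPropagators, Thm 3.1 p.397 (quantifier template), (3.35) p.396,
(3.42) p.397, (3.52) p.400, (3.62)–(3.65) pp.402–403 (shapes, mechanism); Balaban1984PropagatorsI, Prop. 1.2 (1.110) p.35; King1986, Prop. 3.9 (3.73) p.665 (rate factor)] -/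
theorem ne2PlusOperator_firstOrder_fullG (hLodd : Odd L) (hL3 : 3 ≤ L) (hL : Odd L ∧ 1 < L) {a : ℝ} (ha : 0 < a) (c35 : ℝ) (hc35 : 0 < c35) (ν μ : Fin (d + 1)) :
    NE2PlusOperator c35 (foInstanceFG d hL) (foFamilyFG d hL a ν μ) := by
  have hL2 : 2 ≤ L := by omega
  have hL1 : (1 : ℝ) ≤ (L : ℝ) := by exact_mod_cast (show 1 ≤ L by omega)
  have hLr : (0 : ℝ) < (L : ℝ) := by positivity
  set γ₀ : ℝ := min (1 / 16) (1 / (8 * ((d : ℝ) + 1))) with hγ₀def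
  have hd8 : (0 : ℝ) < 1 / (8 * ((d : ℝ) + 1)) := by positivity
  have hγ₀ : 0 < γ₀ := lt_min (by norm_num) hd8
  have hγ₀le : γ₀ ≤ 1 / 16 := min_le_left _ _
  -- entry 0: II-D at `γ := 2γ₀`; entries 1–3: the `U ≡ 1` η-defects of record
  obtain ⟨δE, r₀, B, hδE, hr₀, hB, HFO⟩ := hasMaj_idef_bgPairValue_gOp d hLodd hL3 ha (γ := 2 * γ₀) (by positivity) (by linarith)
  obtain ⟨δ₂, C₁', hδ₂, hC₁', H1⟩ := hasMaj_tgT1 (d := d) hLodd hL2 hL ha ν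
  obtain ⟨δ₃, C₂', hδ₃, hC₂', H2⟩ := hasMaj_tgT2 (d := d) hLodd hL2 hL ha μ
  obtain ⟨δ₄, C₃', hδ₄, hC₃', H3⟩ := hasMaj_twoGridDefect_lap (d := d) hLodd hL2 ha (γ := 2 * γ₀) (by positivity) (by linarith)
  set ρ₃ : ℝ := min δ₂ (min δ₃ δ₄) with hρ₃def
  have hρ₃ : 0 < ρ₃ := lt_min hδ₂ (lt_min hδ₃ hδ₄)
  set B₃ : ℝ := max C₁' (max C₂' C₃') with hB₃def
  have hB₃ : 0 ≤ B₃ := hC₁'.le.trans (le_max_left _ _)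
  set δ₀ : ℝ := min δE ρ₃ with hδ₀def
  have hδ₀ : 0 < δ₀ := lt_min hδE hρ₃
  set B₀ : ℝ := max (B * (1 + 2 * ((d : ℝ) + 1) * r₀)) B₃ with hB₀def
  have hBB : 0 < B * (1 + 2 * ((d : ℝ) + 1) * r₀) := by positivity
  have hB₀ : 0 < B₀ := hBB.trans_le (le_max_left _ _)
  refine ⟨1, δ₀, r₀ / c35, B₀, γ₀, one_pos, hδ₀, by positivity, hB₀, hγ₀, fun j _hM α₀ hα₀ hMα U hU => ?_⟩
  -- at the index `j`: the letters of the configuration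
  obtain ⟨hU1, hU2, hU3⟩ := (reg335_coeffBgFO_iff (TGIndex.Mn d hL j.toTGIndex) (L ^ j.m * L ^ j.k) j.Msz c35 α₀ U).1 hU
  have hMsz : (0 : ℝ) ≤ j.Msz := zero_le_one.trans j.one_le_Msz
  have hr0 : 0 ≤ c35 * j.Msz * α₀ := by positivity
  have hrr₀ : c35 * j.Msz * α₀ ≤ r₀ := by
    have h := mul_le_mul_of_nonneg_left hMα hc35.le
    rw [foInstanceFG_gf_M, mul_div_cancel₀ _ hc35.ne'] at h
    linarith [h]
  have hn' : (0 : ℝ) < ((L ^ j.m * L ^ j.k : ℕ) : ℝ) := by positivity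
  have hb' : ∀ μ' z, |((L ^ j.m * L ^ j.k : ℕ) : ℝ) * (U.2 μ' z - U.2 μ' (z.1 - unitVec (fine (L ^ j.m * L ^ j.k) (TGIndex.Mn d hL j.toTGIndex)) μ', z.2))| ≤ c35 * j.Msz * α₀ :=
    fun μ' z => abs_bquot_le_of_fgrad (TGIndex.Mn d hL j.toTGIndex) μ' (hU3 μ' μ') z
  have hfa : ∀ μ' z, |U.2 μ' z - blockAvg (kingPrV L j.k j.m (TGIndex.Mn d hL j.toTGIndex)) (U.2 μ') (kingPrV L j.k j.m (TGIndex.Mn d hL j.toTGIndex) z)| ≤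
      ((2 * ((d + 1) * (L ^ j.m - 1)) : ℕ) : ℝ) * (c35 * j.Msz * α₀ / ((L ^ j.m * L ^ j.k : ℕ) : ℝ)) :=
    fun μ' z => fit_blockAvg _ (fibreOsc_of_fgrad L j.k j.m (TGIndex.Mn d hL j.toTGIndex) hn' fun κ z => hU3 μ' κ z) z
  have hoa : 0 ≤ ((2 * ((d + 1) * (L ^ j.m - 1)) : ℕ) : ℝ) * (c35 * j.Msz * α₀ / ((L ^ j.m * L ^ j.k : ℕ) : ℝ)) := by positivity
  have h0 := HFO j.mT j.k j.m j.one_le hL _ hr0 hrr₀ _ hr0 hrr₀ _ hoa U.1 U.2 hU1 hU2 hb' hfa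
  -- the readout
  have hη : 0 < (unitTorusGeoS L j.k (TGIndex.Mn d hL j.toTGIndex) j.Msz).eta := inv_pos.mpr (pow_pos hLr _)
  have hblk : blkFine L j.k (TGIndex.Mn d hL j.toTGIndex) ∘ kingPrV L j.k j.m (TGIndex.Mn d hL j.toTGIndex) =
      fun i : Tor (fine (L ^ j.m * L ^ j.k) (TGIndex.Mn d hL j.toTGIndex)) × Fin (d + 1) => blockOf (L ^ j.m * L ^ j.k) (TGIndex.Mn d hL j.toTGIndex) i.1 :=
    blkFine_comp_kingPrV (TGIndex.Mn d hL j.toTGIndex) L j.k j.m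
  unfold foFamilyFG
  rw [hblk]
  refine etaRateIneq342_of_hasMaj_rateWeight (g := unitTorusGeoS L j.k (TGIndex.Mn d hL j.toTGIndex) j.Msz) (B := coeffBgFO (TGIndex.Mn d hL j.toTGIndex) (L ^ j.m * L ^ j.k) j.Msz)
    (blkFine L j.k (TGIndex.Mn d hL j.toTGIndex)) (fun i : Tor (fine (L ^ j.m * L ^ j.k) (TGIndex.Mn d hL j.toTGIndex)) × Fin (d + 1) => blockOf (L ^ j.m * L ^ j.k) (TGIndex.Mn d hL j.toTGIndex) i.1)
    hη hLr hB₀.le (c := ![B * (1 + 2 * ((d : ℝ) + 1) * r₀), B₃, B₃, B₃]) (fun n => by fin_cases n <;> simp <;> positivity) (fun n y => ?_) _ U fun n => ?_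
  · -- `c n ≤ B₀ ≤ B₀·pref4`
    have hlen : 1 ≤ (unitTorusGeoS L j.k (TGIndex.Mn d hL j.toTGIndex) j.Msz).len y := by
      show (1 : ℝ) ≤ (L : ℝ) ^ j.k * (((L : ℝ) ^ j.k)⁻¹)
      rw [mul_inv_cancel₀ (pow_ne_zero _ hLr.ne')]
    have hpref := one_le_pref4 hlen n
    have hcn : (![B * (1 + 2 * ((d : ℝ) + 1) * r₀), B₃, B₃, B₃] : Fin 4 → ℝ) n ≤ B₀ := by
      fin_cases n
      · exact le_max_left _ _
      · exact le_max_right _ _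
      · exact le_max_right _ _
      · exact le_max_right _ _
    calc _ ≤ B₀ := hcn
      _ = B₀ * 1 := (mul_one _).symm
      _ ≤ _ := mul_le_mul_of_nonneg_left hpref hB₀.le
  · have hγ₁ : γ₀ ≤ 1 / 16 := hγ₀le
    have hγ₂ : γ₀ ≤ 1 / (8 * ((d : ℝ) + 1)) := min_le_right _ _
    have hγ₃ : γ₀ ≤ 2 * γ₀ / 2 := by linarith
    have hrw : ∀ y' : Tor (TGIndex.Mn d hL j.toTGIndex), rateWeight (unitTorusGeoS L j.k (TGIndex.Mn d hL j.toTGIndex) j.Msz) γ₀ y' = ((L : ℝ) ^ j.k) ^ (-γ₀) :=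
      fun y' => rateWeight_unitTorusGeoS L (TGIndex.Mn d hL j.toTGIndex) j.k j.Msz γ₀ y'
    fin_cases n
    · -- entry 0: II-D, with the derived fit absorbed into the rate
      have hcast : ((L ^ j.k : ℕ) : ℝ) = (L : ℝ) ^ j.k := by push_cast; ring
      have hq : (-(2 * γ₀ / 2)) = -γ₀ := by ring
      have hosc := osc_rate_le (d := d) j.k j.m hL1 (γ := γ₀) hr0 hrr₀ (by linarith)
      have hθ : 0 ≤ ((L : ℝ) ^ j.k) ^ (-γ₀) := Real.rpow_nonneg (pow_nonneg hLr.le _) _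
      have hδ₀E : δ₀ ≤ δE := by rw [hδ₀def]; exact min_le_left _ _
      refine h0.mono fun y y' => ?_
      show _ ≤ B * (1 + 2 * ((d : ℝ) + 1) * r₀) * Real.exp (-(δ₀ * tdistT (MP (paramsOf d L j.mT j.k hL)) y y')) *
        rateWeight (unitTorusGeoS L j.k (TGIndex.Mn d hL j.toTGIndex) j.Msz) γ₀ y'
      rw [hcast, hq, hrw]
      have ht := tdistT_nonneg (MP (paramsOf d L j.mT j.k hL)) y y'
      have hexp : Real.exp (-(δE * tdistT (MP (paramsOf d L j.mT j.k hL)) y y')) ≤ Real.exp (-(δ₀ * tdistT (MP (paramsOf d L j.mT j.k hL)) y y')) :=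
        Real.exp_le_exp.mpr (by nlinarith [mul_le_mul_of_nonneg_right hδ₀E ht])
      have hsum : ((L : ℝ) ^ j.k) ^ (-γ₀) + ((2 * ((d + 1) * (L ^ j.m - 1)) : ℕ) : ℝ) * (c35 * j.Msz * α₀ / ((L ^ j.m * L ^ j.k : ℕ) : ℝ)) ≤
          (1 + 2 * ((d : ℝ) + 1) * r₀) * ((L : ℝ) ^ j.k) ^ (-γ₀) := by nlinarith [hosc]
      calc B * (((L : ℝ) ^ j.k) ^ (-γ₀) + ((2 * ((d + 1) * (L ^ j.m - 1)) : ℕ) : ℝ) * (c35 * j.Msz * α₀ / ((L ^ j.m * L ^ j.k : ℕ) : ℝ))) *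
            Real.exp (-(δE * tdistT (MP (paramsOf d L j.mT j.k hL)) y y'))
          ≤ B * ((1 + 2 * ((d : ℝ) + 1) * r₀) * ((L : ℝ) ^ j.k) ^ (-γ₀)) * Real.exp (-(δ₀ * tdistT (MP (paramsOf d L j.mT j.k hL)) y y')) :=
            mul_le_mul (mul_le_mul_of_nonneg_left hsum hB.le) hexp (Real.exp_nonneg _) (by positivity)
        _ = _ := by ring
    · have e := hasMaj_rescale hL1 hB₃ (le_max_left _ _) hγ₁ ((min_le_right δE ρ₃).trans (min_le_left _ _)) (H1 j.toTGIndex)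
      exact e.mono fun y y' => le_of_eq (by rw [hrw]; simp; ring)
    · have e := hasMaj_rescale hL1 hB₃ ((le_max_left _ _).trans (le_max_right _ _)) hγ₂ ((min_le_right δE ρ₃).trans ((min_le_right _ _).trans (min_le_left _ _))) (H2 j.toTGIndex)
      exact e.mono fun y y' => le_of_eq (by rw [hrw]; simp; ring)
    · have hcast : ((L ^ j.k : ℕ) : ℝ) = (L : ℝ) ^ j.k := by push_cast; ring
      have e3 := (H3 j.mT j.k j.m j.one_le hL).mono
        (K' := fun y y' => C₃' * ((L : ℝ) ^ j.k) ^ (-(2 * γ₀ / 2)) * Real.exp (-(δ₄ * tdistT (MP (paramsOf d L j.mT j.k hL)) y y'))) fun y y' => by rw [hcast]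
      have e := hasMaj_rescale hL1 hB₃ ((le_max_right _ _).trans (le_max_right _ _)) hγ₃ ((min_le_right δE ρ₃).trans ((min_le_right _ _).trans (min_le_right _ _))) e3
      exact e.mono fun y y' => le_of_eq (by rw [hrw]; simp; ring)

/-- ★★ **NE2⁰ FOR THE SAME FAMILY — `T4EtaRate.NE2ZeroOperator` BY NAME**: the trivial family `U = 0` is regular for every `α₀ > 0` under the guard, so `ne2Zero_of_ne2Plus` applies.
[cite: King1986, Props. 3.8–3.9 (3.71)–(3.75) pp.664–665 (A = 0 model); Balaban1985BackgroundPropagators, Thm 3.1 p.397 (quantifier template)] -/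
theorem ne2ZeroOperator_firstOrder_fullG (hLodd : Odd L) (hL3 : 3 ≤ L) (hL : Odd L ∧ 1 < L) {a : ℝ} (ha : 0 < a) {c35 : ℝ} (hc35 : 0 < c35) (ν μ : Fin (d + 1)) :
    NE2ZeroOperator (foInstanceFG d hL) (foFamilyFG d hL a ν μ) := by
  refine ne2Zero_of_ne2Plus (c35 := c35) (fun j α₀ hα₀ => ?_) (ne2PlusOperator_firstOrder_fullG d hLodd hL3 hL ha c35 hc35 ν μ)
  have hM : (0 : ℝ) ≤ j.Msz := zero_le_one.trans j.one_le_Msz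
  have h0 : (0 : ℝ) ≤ c35 * j.Msz * α₀ := by positivity
  refine (reg335_coeffBgFO_iff (TGIndex.Mn d hL j.toTGIndex) (L ^ j.m * L ^ j.k) j.Msz c35 α₀ _).2 ⟨fun z => ?_, fun μ' z => ?_, fun μ' κ z => ?_⟩
  · show |(0 : ℝ)| ≤ _; rw [abs_zero]; exact h0
  · show |(0 : ℝ)| ≤ _; rw [abs_zero]; exact h0
  · rw [fgrad_apply]
    show |((L ^ j.m * L ^ j.k : ℕ) : ℝ) * ((0 : ℝ) - 0)| ≤ _
    rw [sub_zero, mul_zero, abs_zero]; exact h0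

end Main

end Summit.QuantumFields.YangMills.BalabanUVNodes.N15.TwoGrid

end
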